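import Summits.CriticalPhenomena.Ising3D.TaylorGerm
import Literature.MathematicalPhysics.QuantumFieldTheory.ConformalBootstrap3D.DualFunctional
import Mathlib.Algebra.BigOperators.Group.Finset.Basic
import Mathlib.Tactic.Linarith
import Mathlib.Tactic.Positivity
import Mathlib.Tactic.Ring
import HarnessLib

/-!
# Taylor (derivative) functionals: termwise action on the `σ–ε` sum rules from germ majorants
(cell `pub-ising3x`, seat boot-1; gate (g0) of the M3-γ milestone, part 2 of 3)

HONEST FRAMING: lottery ticket; floor = tightest certified 3D Ising CFT bounds; no exact-solution
claim without a proof.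

Part 1 (`TaylorGerm.lean`) built the linear functionals `taylorCoeffAt x₀ y₀ (a,b)` on all
functions `ℝ → ℝ → ℝ`. Here:

* `IsTaylorFunctional x₀ y₀ φ` — `φ` is a finite real combination of the `taylorCoeffAt x₀ y₀ p`
  (the typed form of a DERIVATIVE functional `∑ c_{ab} ∂_z^a ∂_z̄^b |_{(x₀,y₀)}` of the numerical
  bootstrap, Kos–Poland–Simmons-Duffin 2014 eq. (3.17), up to the factorial normalisation);
* `hasTaylorGerm_of_majorant` — **the Weierstrass M-test for germs**: if `F_i` have germs `T_i` at
  `(x₀,y₀)` with `∑_i |c_i| N_i < ∞`, `N_i = ∑_{ab} |T_{i,ab}| ρ^{a+b}`, and `∑_i c_i F_i = S`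
  pointwise on the square of half-width `ρ`, then `S` has the germ `∑_i c_i T_i` there (Fubini for
  absolutely convergent double families) — hence `IsTaylorFunctional.hasSum_mul`:
  `∑_i c_i φ(F_i) = φ(S)`, the analogue of `EvaluationContinuous.hasSum_mul` of the tree;
* `taylorCrossing x₀ y₀ s w : CrossingFunctional` (five Taylor functionals at one point) and
  `IsTaylorAt`;
* `HasCrossFGerms D x₀ y₀ ρ` — the ANALYTIC INPUT, isolated: the seven term families of
  `CrossingFunctional.AppliesTermwise` (`crossF` of the blocks `gp`, `gmm`, `gpm` with the right
  prefactor exponents and signs) have germs at `(x₀,y₀)` with majorants summable against the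
  weights of the sum rules (`HasSummableGerms`);
* `appliesTermwise_of_isTaylorAt` — A3 (crossing) + `HasCrossFGerms` ⇒ `AppliesTermwise` for every
  Taylor crossing functional at that point; `boxExcluded_of_isTaylorAt` — the certificate-facing
  corollary, conditional on part 3's theorem that every datum satisfying A1–A2 has `HasCrossFGerms`
  at every point of the open square (stated here as the hypothesis `hG`).

Nothing here is specific to conformal blocks; part 3 discharges `HasCrossFGerms` from
`SatisfiesBootstrapAxioms` (binomial re-expansion of the `z`-series, non-negativity of the `gp`/`gpm`
arrays, coefficient-level domination of `gmm`, the A1 clause `HasConvergentWeights`).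
Sources: F. Kos, D. Poland, D. Simmons-Duffin, JHEP 11 (2014) 109, §3.2–3.3 (eq. (3.17)); the
M-test is elementary (Mathlib `HasSum.prod_fiberwise`, `summable_prod_of_nonneg`).
-/

namespace Summit.CriticalPhenomena.Ising3D

open Set Finset
open Literature.MathematicalPhysics.QuantumFieldTheory.ConformalBootstrap3D

/-! ### The M-test for germs -/

/-- A single coefficient is bounded by the majorant: `|T p| ρ^a ρ^b ≤ N`. [folklore] -/
theorem abs_mul_pow_le_of_hasSum {T : ℕ × ℕ → ℝ} {ρ N : ℝ} (hρ : 0 ≤ ρ)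
    (hN : HasSum (fun p : ℕ × ℕ => |T p| * ρ ^ p.1 * ρ ^ p.2) N) (p : ℕ × ℕ) :
    |T p| * ρ ^ p.1 * ρ ^ p.2 ≤ N :=
  le_hasSum hN p fun q _ => by positivity

/-- **Weierstrass M-test for Taylor germs.** Germs `T_i` of `F_i` at `(x₀,y₀)` (common radius
`r`), majorants `N_i = ∑ |T_{i,ab}| ρ^{a+b}` (`0 < ρ ≤ r`) with `∑ |c_i| N_i < ∞`, and
`∑_i c_i F_i = S` on the square of half-width `ρ`: then `S` has the germ `ab ↦ ∑_i c_i T_{i,ab}`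
of radius `ρ`, each of these coefficient series converging. [folklore] -/
theorem hasTaylorGerm_of_majorant {ι : Type*} (c : ι → ℝ) (F : ι → ℝ → ℝ → ℝ) (S : ℝ → ℝ → ℝ)
    {x₀ y₀ r ρ : ℝ} (T : ι → ℕ × ℕ → ℝ) (N : ι → ℝ)
    (hT : ∀ i, HasTaylorGerm (F i) x₀ y₀ r (T i)) (hρ : 0 < ρ) (hρr : ρ ≤ r)
    (hN : ∀ i, HasSum (fun p : ℕ × ℕ => |T i p| * ρ ^ p.1 * ρ ^ p.2) (N i))
    (hc : Summable fun i => |c i| * N i)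
    (hS : ∀ h k : ℝ, |h| < ρ → |k| < ρ →
      HasSum (fun i => c i * F i (x₀ + h) (y₀ + k)) (S (x₀ + h) (y₀ + k))) :
    HasTaylorGerm S x₀ y₀ ρ (fun p => ∑' i, c i * T i p) ∧
      ∀ p : ℕ × ℕ, HasSum (fun i => c i * T i p) (∑' i, c i * T i p) := by
  -- each coefficient series converges absolutely
  have hcoef : ∀ p : ℕ × ℕ, Summable fun i => c i * T i p := by
    intro p
    have hρp : 0 < ρ ^ p.1 * ρ ^ p.2 := by positivity
    refine Summable.of_norm_bounded (g := fun i => |c i| * N i * (ρ ^ p.1 * ρ ^ p.2)⁻¹)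
      (hc.mul_right _) fun i => ?_
    rw [Real.norm_eq_abs, abs_mul]
    have h1 := abs_mul_pow_le_of_hasSum hρ.le (hN i) p
    rw [le_mul_inv_iff₀ hρp]
    calc |c i| * |T i p| * (ρ ^ p.1 * ρ ^ p.2) = |c i| * (|T i p| * ρ ^ p.1 * ρ ^ p.2) := by ring
      _ ≤ |c i| * N i := mul_le_mul_of_nonneg_left h1 (abs_nonneg _)
  refine ⟨⟨hρ, fun h k hh hk => ?_⟩, fun p => (hcoef p).hasSum⟩
  have hh0 : 0 ≤ |h| := abs_nonneg _
  have hk0 : 0 ≤ |k| := abs_nonneg _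
  -- the non-negative dominating family on `ι × (ℕ × ℕ)` is summable
  set g : ι × (ℕ × ℕ) → ℝ := fun q => |c q.1| * (|T q.1 q.2| * |h| ^ q.2.1 * |k| ^ q.2.2) with hg
  have hg0 : 0 ≤ g := fun q => by positivity
  have hgi : ∀ i, HasSum (fun p : ℕ × ℕ => g (i, p))
      (|c i| * ∑' p : ℕ × ℕ, |T i p| * |h| ^ p.1 * |k| ^ p.2) := fun i =>
    ((hT i).summable_abs (lt_of_lt_of_le hh hρr) (lt_of_lt_of_le hk hρr)).hasSum.mul_left _
  have hgsum : Summable g := by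
    refine (summable_prod_of_nonneg hg0).mpr ⟨fun i => (hgi i).summable, ?_⟩
    refine hc.of_nonneg_of_le (fun i => ?_) fun i => ?_
    · rw [(hgi i).tsum_eq]
      exact mul_nonneg (abs_nonneg _) (tsum_nonneg fun p => by positivity)
    · rw [(hgi i).tsum_eq]
      refine mul_le_mul_of_nonneg_left ?_ (abs_nonneg _)
      refine hasSum_le (fun p => ?_)
        ((hT i).summable_abs (lt_of_lt_of_le hh hρr) (lt_of_lt_of_le hk hρr)).hasSum (hN i)
      have h1 : |h| ^ p.1 ≤ ρ ^ p.1 := pow_le_pow_left₀ hh0 hh.le _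
      have h2 : |k| ^ p.2 ≤ ρ ^ p.2 := pow_le_pow_left₀ hk0 hk.le _
      have h3 : 0 ≤ |T i p| := abs_nonneg _
      calc |T i p| * |h| ^ p.1 * |k| ^ p.2 = |T i p| * (|h| ^ p.1 * |k| ^ p.2) := by ring
        _ ≤ |T i p| * (ρ ^ p.1 * ρ ^ p.2) :=
          mul_le_mul_of_nonneg_left (mul_le_mul h1 h2 (by positivity) (by positivity)) h3
        _ = _ := by ring
  -- the signed family
  set f : ι × (ℕ × ℕ) → ℝ := fun q => c q.1 * T q.1 q.2 * h ^ q.2.1 * k ^ q.2.2 with hf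
  have hfg : ∀ q, ‖f q‖ ≤ g q := fun q => by
    rw [Real.norm_eq_abs, hf, hg]
    simp only [abs_mul, abs_pow]
    ring_nf
    rfl
  have hfsum : Summable f := Summable.of_norm_bounded hgsum hfg
  -- summing over `p` first: the value `S`
  have hfi : ∀ i, HasSum (fun p : ℕ × ℕ => f (i, p)) (c i * F i (x₀ + h) (y₀ + k)) := fun i =>
    (((hT i).hasSum (lt_of_lt_of_le hh hρr) (lt_of_lt_of_le hk hρr)).mul_left (c i)).congr_fun
      fun p => by simp only [hf]; ring
  have hval : HasSum f (S (x₀ + h) (y₀ + k)) := by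
    have h1 := hfsum.hasSum.prod_fiberwise hfi
    have heq : ∑' q, f q = S (x₀ + h) (y₀ + k) := h1.unique (hS h k hh hk)
    rw [← heq]
    exact hfsum.hasSum
  -- summing over `i` first: the coefficient series
  have hswap : HasSum (fun q : (ℕ × ℕ) × ι => f q.swap) (S (x₀ + h) (y₀ + k)) :=
    (Equiv.prodComm (ℕ × ℕ) ι).hasSum_iff.mpr hval
  have hfp : ∀ p : ℕ × ℕ, HasSum (fun i => f (i, p)) ((∑' i, c i * T i p) * h ^ p.1 * k ^ p.2) :=
    fun p => (((hcoef p).hasSum.mul_right (h ^ p.1)).mul_right (k ^ p.2)).congr_fun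
      fun i => by simp only [hf]
  refine ⟨?_, hswap.prod_fiberwise fun p => hfp p⟩
  -- absolute summability of the resulting expansion
  have hgswap : Summable fun q : (ℕ × ℕ) × ι => g q.swap := hgsum.prod_symm
  have hgp : Summable fun p : ℕ × ℕ => ∑' i, g (i, p) := hgswap.prod
  refine hgp.of_nonneg_of_le (fun p => by positivity) fun p => ?_
  have hgp' : Summable fun i => g (i, p) := hgswap.prod_factor p
  have hn : Summable fun i => ‖c i * T i p‖ := by
    refine Summable.of_norm_bounded (g := fun i => |c i| * N i * (ρ ^ p.1 * ρ ^ p.2)⁻¹)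
      (hc.mul_right _) fun i => ?_
    rw [norm_norm, Real.norm_eq_abs, abs_mul, le_mul_inv_iff₀ (by positivity)]
    calc |c i| * |T i p| * (ρ ^ p.1 * ρ ^ p.2) = |c i| * (|T i p| * ρ ^ p.1 * ρ ^ p.2) := by ring
      _ ≤ |c i| * N i := mul_le_mul_of_nonneg_left (abs_mul_pow_le_of_hasSum hρ.le (hN i) p)
          (abs_nonneg _)
  calc |∑' i, c i * T i p| * |h| ^ p.1 * |k| ^ p.2
      ≤ (∑' i, |c i * T i p|) * |h| ^ p.1 * |k| ^ p.2 := by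
        gcongr
        have := norm_tsum_le_tsum_norm hn
        simpa only [Real.norm_eq_abs] using this
    _ = ∑' i, g (i, p) := by
        rw [← tsum_mul_right, ← tsum_mul_right]
        refine tsum_congr fun i => ?_
        simp only [hg, abs_mul]
        ring

/-! ### Taylor functionals -/

/-- `φ` is a finite real combination of Taylor-coefficient functionals at `(x₀, y₀)` — the typed
form of a derivative functional `∑ c_{ab} ∂_z^a ∂_z̄^b|_{(x₀,y₀)}` (Kos–Poland–Simmons-Duffin 2014
eq. (3.17), up to factorials). [cite: KosPolandSimmonsduffin2014, §3.3 eq. (3.17)] -/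
def IsTaylorFunctional (x₀ y₀ : ℝ) (φ : (ℝ → ℝ → ℝ) →ₗ[ℝ] ℝ) : Prop :=
  ∃ (s : Finset (ℕ × ℕ)) (w : ℕ × ℕ → ℝ), φ = ∑ p ∈ s, w p • taylorCoeffAt x₀ y₀ p

namespace IsTaylorFunctional

variable {x₀ y₀ : ℝ} {φ ψ : (ℝ → ℝ → ℝ) →ₗ[ℝ] ℝ}

/-- A single Taylor coefficient is a Taylor functional. [folklore] -/
theorem taylorCoeffAt (x₀ y₀ : ℝ) (p : ℕ × ℕ) : IsTaylorFunctional x₀ y₀ (taylorCoeffAt x₀ y₀ p) :=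
  ⟨{p}, fun _ => 1, by simp⟩

/-- The zero functional is a Taylor functional. [folklore] -/
theorem zero (x₀ y₀ : ℝ) : IsTaylorFunctional x₀ y₀ 0 := ⟨∅, fun _ => 0, by simp⟩

/-- Evaluation on a function with a germ: the finite combination of its coefficients. [folklore] -/
theorem apply_eq_sum {s : Finset (ℕ × ℕ)} {w : ℕ × ℕ → ℝ}
    (hφ : φ = ∑ p ∈ s, w p • Ising3D.taylorCoeffAt x₀ y₀ p) {F : ℝ → ℝ → ℝ} {r : ℝ}
    {T : ℕ × ℕ → ℝ} (hF : HasTaylorGerm F x₀ y₀ r T) : φ F = ∑ p ∈ s, w p * T p := by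
  subst hφ
  rw [LinearMap.sum_apply]
  refine Finset.sum_congr rfl fun p _ => ?_
  rw [LinearMap.smul_apply, taylorCoeffAt_eq hF p, smul_eq_mul]

/-- A Taylor functional kills every function vanishing on a square around the point.
[folklore] -/
theorem map_eq_zero_of_eqOn (hφ : IsTaylorFunctional x₀ y₀ φ) {r : ℝ} (hr : 0 < r)
    {F : ℝ → ℝ → ℝ} (h0 : ∀ h k : ℝ, |h| < r → |k| < r → F (x₀ + h) (y₀ + k) = 0) : φ F = 0 := by
  obtain ⟨s, w, rfl⟩ := hφ
  rw [LinearMap.sum_apply]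
  refine Finset.sum_eq_zero fun p _ => ?_
  rw [LinearMap.smul_apply, taylorCoeffAt_apply, taylorCoeff_eq_zero_of_eqOn hr h0]
  simp

/-- **Termwise action of a Taylor functional** (analogue of `EvaluationContinuous.hasSum_mul`):
under the hypotheses of the M-test, `∑_i c_i φ(F_i) = φ(S)`. [folklore] -/
theorem hasSum_mul (hφ : IsTaylorFunctional x₀ y₀ φ) {ι : Type*} (c : ι → ℝ)
    (F : ι → ℝ → ℝ → ℝ) (S : ℝ → ℝ → ℝ) {r ρ : ℝ} (T : ι → ℕ × ℕ → ℝ) (N : ι → ℝ)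
    (hT : ∀ i, HasTaylorGerm (F i) x₀ y₀ r (T i)) (hρ : 0 < ρ) (hρr : ρ ≤ r)
    (hN : ∀ i, HasSum (fun p : ℕ × ℕ => |T i p| * ρ ^ p.1 * ρ ^ p.2) (N i))
    (hc : Summable fun i => |c i| * N i)
    (hS : ∀ h k : ℝ, |h| < ρ → |k| < ρ →
      HasSum (fun i => c i * F i (x₀ + h) (y₀ + k)) (S (x₀ + h) (y₀ + k))) :
    HasSum (fun i => c i * φ (F i)) (φ S) := by
  obtain ⟨hgerm, hco⟩ := hasTaylorGerm_of_majorant c F S T N hT hρ hρr hN hc hS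
  obtain ⟨s, w, hsw⟩ := hφ
  have hFi : ∀ i, φ (F i) = ∑ p ∈ s, w p * T i p := fun i => apply_eq_sum hsw (hT i)
  have hSv : φ S = ∑ p ∈ s, w p * ∑' i, c i * T i p := apply_eq_sum hsw hgerm
  rw [hSv]
  have h1 : HasSum (fun i => ∑ p ∈ s, w p * (c i * T i p)) (∑ p ∈ s, w p * ∑' i, c i * T i p) :=
    hasSum_sum fun p _ => (hco p).mul_left (w p)
  refine h1.congr_fun fun i => ?_
  rw [hFi i, Finset.mul_sum]
  exact Finset.sum_congr rfl fun p _ => by ring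

end IsTaylorFunctional

/-- Family-level analytic hypothesis: the `F_i` have germs at `(x₀,y₀)` of some common radius
`r ≥ ρ` whose majorants at radius `ρ` are summable against the weights `|c_i|`. [folklore] -/
def HasSummableGerms {ι : Type*} (c : ι → ℝ) (F : ι → ℝ → ℝ → ℝ) (x₀ y₀ ρ : ℝ) : Prop :=
  ∃ (r : ℝ) (T : ι → ℕ × ℕ → ℝ) (N : ι → ℝ), ρ ≤ r ∧ (∀ i, HasTaylorGerm (F i) x₀ y₀ r (T i)) ∧
    (∀ i, HasSum (fun p : ℕ × ℕ => |T i p| * ρ ^ p.1 * ρ ^ p.2) (N i)) ∧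
      Summable fun i => |c i| * N i

/-- Termwise action from `HasSummableGerms`. [folklore] -/
theorem IsTaylorFunctional.hasSum_mul_of_hasSummableGerms {x₀ y₀ : ℝ}
    {φ : (ℝ → ℝ → ℝ) →ₗ[ℝ] ℝ} (hφ : IsTaylorFunctional x₀ y₀ φ) {ι : Type*} {c : ι → ℝ}
    {F : ι → ℝ → ℝ → ℝ} {ρ : ℝ} (hρ : 0 < ρ) (hG : HasSummableGerms c F x₀ y₀ ρ)
    (S : ℝ → ℝ → ℝ) (hS : ∀ h k : ℝ, |h| < ρ → |k| < ρ →
      HasSum (fun i => c i * F i (x₀ + h) (y₀ + k)) (S (x₀ + h) (y₀ + k))) :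
    HasSum (fun i => c i * φ (F i)) (φ S) := by
  obtain ⟨r, T, N, hρr, hT, hN, hc⟩ := hG
  exact hφ.hasSum_mul c F S T N hT hρ hρr hN hc hS

/-! ### Taylor crossing functionals and the `σ–ε` sum rules -/

/-- All five components of `α⃗` are Taylor functionals at the same point `(x₀, y₀)`. [folklore] -/
def IsTaylorAt (α : CrossingFunctional) (x₀ y₀ : ℝ) : Prop :=
  IsTaylorFunctional x₀ y₀ α.α₁ ∧ IsTaylorFunctional x₀ y₀ α.α₂ ∧ IsTaylorFunctional x₀ y₀ α.α₃ ∧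
    IsTaylorFunctional x₀ y₀ α.α₄ ∧ IsTaylorFunctional x₀ y₀ α.α₅

/-- A concrete derivative (`Taylor`) crossing functional: `αⁱ = ∑_{p ∈ s} w i p · taylorCoeffAt x₀ y₀ p`
— what a Λ-derivative certificate instantiates (`s` = the index set `a + b ≤ Λ`, `w` rational).
[cite: KosPolandSimmonsduffin2014, §3.3 eq. (3.17)] -/
noncomputable def taylorCrossing (x₀ y₀ : ℝ) (s : Finset (ℕ × ℕ)) (w : Fin 5 → ℕ × ℕ → ℝ) :
    CrossingFunctional :=
  ⟨∑ p ∈ s, w 0 p • taylorCoeffAt x₀ y₀ p, ∑ p ∈ s, w 1 p • taylorCoeffAt x₀ y₀ p,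
    ∑ p ∈ s, w 2 p • taylorCoeffAt x₀ y₀ p, ∑ p ∈ s, w 3 p • taylorCoeffAt x₀ y₀ p,
    ∑ p ∈ s, w 4 p • taylorCoeffAt x₀ y₀ p⟩

/-- `taylorCrossing` is Taylor at its point. [folklore] -/
theorem isTaylorAt_taylorCrossing (x₀ y₀ : ℝ) (s : Finset (ℕ × ℕ)) (w : Fin 5 → ℕ × ℕ → ℝ) :
    IsTaylorAt (taylorCrossing x₀ y₀ s w) x₀ y₀ :=
  ⟨⟨s, w 0, rfl⟩, ⟨s, w 1, rfl⟩, ⟨s, w 2, rfl⟩, ⟨s, w 3, rfl⟩, ⟨s, w 4, rfl⟩⟩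

/-- **The analytic input of T4 for derivative functionals, isolated.** At the point `(x₀, y₀)`,
with a majorant radius `ρ > 0` keeping the square inside `(0,1)²`, the seven term families of
`CrossingFunctional.AppliesTermwise` for the datum `D` — `F^{σσ,σσ}_-`, `F^{εε,εε}_-`,
`F^{σε,σε}_-` (block `gmm`, weights `(-1)^ℓ λ²`), the even and odd halves of rules 4 and 5 — have
Taylor germs with majorants summable against the sum-rule weights. Part 3 proves this from A1–A2.
[folklore] -/
structure HasCrossFGerms (D : SigmaEpsilonData) (x₀ y₀ ρ : ℝ) : Prop where
  /-- `ρ > 0`. -/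
  pos : 0 < ρ
  /-- The square of half-width `ρ` around `(x₀,y₀)` lies in the open unit square. -/
  left : ρ < x₀
  /-- (continued) -/
  right : x₀ + ρ < 1
  /-- (continued) -/
  low : ρ < y₀
  /-- (continued) -/
  high : y₀ + ρ < 1
  /-- Rule 1 terms. -/
  rule1 : HasSummableGerms (fun i => D.lamσσ i ^ 2) (fun i => crossF D.Δσ (-1) (D.gp i)) x₀ y₀ ρ
  /-- Rule 2 terms. -/
  rule2 : HasSummableGerms (fun i => D.lamεε i ^ 2) (fun i => crossF D.Δε (-1) (D.gp i)) x₀ y₀ ρ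
  /-- Rule 3 terms (signed block family `gmm`). -/
  rule3 : HasSummableGerms (fun j => (-1 : ℝ) ^ D.ℓm j * D.lamσε j ^ 2)
    (fun j => crossF ((D.Δσ + D.Δε) / 2) (-1) (D.gmm j)) x₀ y₀ ρ
  /-- Rule 4, even part. -/
  rule4p : HasSummableGerms (fun i => D.lamσσ i * D.lamεε i)
    (fun i => crossF ((D.Δσ + D.Δε) / 2) (-1) (D.gp i)) x₀ y₀ ρ
  /-- Rule 4, odd part. -/
  rule4m : HasSummableGerms (fun j => D.lamσε j ^ 2) (fun j => crossF D.Δσ (-1) (D.gpm j)) x₀ y₀ ρ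
  /-- Rule 5, even part. -/
  rule5p : HasSummableGerms (fun i => D.lamσσ i * D.lamεε i)
    (fun i => crossF ((D.Δσ + D.Δε) / 2) 1 (D.gp i)) x₀ y₀ ρ
  /-- Rule 5, odd part. -/
  rule5m : HasSummableGerms (fun j => D.lamσε j ^ 2) (fun j => crossF D.Δσ 1 (D.gpm j)) x₀ y₀ ρ

namespace HasCrossFGerms

variable {D : SigmaEpsilonData} {x₀ y₀ ρ : ℝ}

/-- Points of the square are points of the open unit square. [folklore] -/
theorem mem_Ioo (hG : HasCrossFGerms D x₀ y₀ ρ) {h k : ℝ} (hh : |h| < ρ) (hk : |k| < ρ) :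
    x₀ + h ∈ Set.Ioo (0 : ℝ) 1 ∧ y₀ + k ∈ Set.Ioo (0 : ℝ) 1 := by
  have h1 := hG.left; have h2 := hG.right; have h3 := hG.low; have h4 := hG.high
  rw [abs_lt] at hh hk; exact ⟨⟨by linarith, by linarith⟩, ⟨by linarith, by linarith⟩⟩

end HasCrossFGerms

/-- **T4 for derivative functionals (modulo part 3).** A3 (the five crossing sum rules on the
square) and `HasCrossFGerms D x₀ y₀ ρ` imply `AppliesTermwise` for every crossing functional that
is Taylor at `(x₀, y₀)`. Rules 1–3: the M-test with `S = -F_𝟙` resp. `0`; rules 4–5: the M-test for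
the even and odd parts separately with `S` the pointwise sums, and the scalar identity because
`F_𝟙 + S_even + S_odd` vanishes on the square, hence is killed by a Taylor functional. [folklore] -/
theorem appliesTermwise_of_isTaylorAt (α : CrossingFunctional) {x₀ y₀ ρ : ℝ}
    (hα : IsTaylorAt α x₀ y₀) (D : SigmaEpsilonData) (hC : D.SatisfiesCrossing)
    (hG : HasCrossFGerms D x₀ y₀ ρ) : α.AppliesTermwise D := by
  obtain ⟨hα1, hα2, hα3, hα4, hα5⟩ := hα
  have hρ := hG.pos; refine ⟨?_, ?_, ?_, ?_, ?_⟩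
  · -- rule 1
    have hs := hα1.hasSum_mul_of_hasSummableGerms hρ hG.rule1
      (fun z zb => -(crossF D.Δσ (-1) (fun _ _ => (1 : ℝ)) z zb)) fun h k hh hk => by
        obtain ⟨hz, hzb⟩ := hG.mem_Ioo hh hk
        exact (hC _ _ hz hzb).1
    have hneg : α.α₁ (fun z zb => -(crossF D.Δσ (-1) (fun _ _ => (1 : ℝ)) z zb))
        = -(α.α₁ (crossF D.Δσ (-1) (fun _ _ => (1 : ℝ)))) := by
      rw [← map_neg]; rfl
    simpa [hneg] using hs
  · -- rule 2
    have hs := hα2.hasSum_mul_of_hasSummableGerms hρ hG.rule2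
      (fun z zb => -(crossF D.Δε (-1) (fun _ _ => (1 : ℝ)) z zb)) fun h k hh hk => by
        obtain ⟨hz, hzb⟩ := hG.mem_Ioo hh hk
        exact (hC _ _ hz hzb).2.1
    have hneg : α.α₂ (fun z zb => -(crossF D.Δε (-1) (fun _ _ => (1 : ℝ)) z zb))
        = -(α.α₂ (crossF D.Δε (-1) (fun _ _ => (1 : ℝ)))) := by
      rw [← map_neg]; rfl
    simpa [hneg] using hs
  · -- rule 3
    have hs := hα3.hasSum_mul_of_hasSummableGerms hρ hG.rule3 (fun _ _ => (0 : ℝ))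
      fun h k hh hk => by
        obtain ⟨hz, hzb⟩ := hG.mem_Ioo hh hk
        exact (hC _ _ hz hzb).2.2.1
    have h0 : α.α₃ (fun _ _ => (0 : ℝ)) = 0 := by
      rw [show (fun _ _ => (0 : ℝ)) = (0 : ℝ → ℝ → ℝ) from rfl, map_zero]
    simpa [h0] using hs
  · -- rule 4
    set Fp : ℝ → ℝ → ℝ := fun z zb =>
      ∑' i, D.lamσσ i * D.lamεε i * crossF ((D.Δσ + D.Δε) / 2) (-1) (D.gp i) z zb with hFp
    set Fm : ℝ → ℝ → ℝ := fun z zb => ∑' j, D.lamσε j ^ 2 * crossF D.Δσ (-1) (D.gpm j) z zb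
      with hFm
    have hp := hα4.hasSum_mul_of_hasSummableGerms hρ hG.rule4p Fp fun h k hh hk => by
      obtain ⟨hz, hzb⟩ := hG.mem_Ioo hh hk
      obtain ⟨Sp, Sm, h4p, _, _⟩ := (hC _ _ hz hzb).2.2.2.1
      exact h4p.summable.hasSum
    have hm := hα4.hasSum_mul_of_hasSummableGerms hρ hG.rule4m Fm fun h k hh hk => by
      obtain ⟨hz, hzb⟩ := hG.mem_Ioo hh hk
      obtain ⟨Sp, Sm, _, h4m, _⟩ := (hC _ _ hz hzb).2.2.2.1
      exact h4m.summable.hasSum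
    refine ⟨α.α₄ Fp, α.α₄ Fm, hp, hm, ?_⟩
    have hzero : α.α₄ (crossF ((D.Δσ + D.Δε) / 2) (-1) (fun _ _ => (1 : ℝ)) + Fp + Fm) = 0 := by
      refine hα4.map_eq_zero_of_eqOn hρ fun h k hh hk => ?_
      obtain ⟨hz, hzb⟩ := hG.mem_Ioo hh hk
      obtain ⟨Sp, Sm, h4p, h4m, h4e⟩ := (hC _ _ hz hzb).2.2.2.1
      simp only [Pi.add_apply, hFp, hFm]
      rw [h4p.tsum_eq, h4m.tsum_eq]
      exact h4e
    rw [map_add, map_add] at hzero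
    exact hzero
  · -- rule 5
    set Fp : ℝ → ℝ → ℝ := fun z zb =>
      ∑' i, D.lamσσ i * D.lamεε i * crossF ((D.Δσ + D.Δε) / 2) 1 (D.gp i) z zb with hFp
    set Fm : ℝ → ℝ → ℝ := fun z zb => ∑' j, D.lamσε j ^ 2 * crossF D.Δσ 1 (D.gpm j) z zb
      with hFm
    have hp := hα5.hasSum_mul_of_hasSummableGerms hρ hG.rule5p Fp fun h k hh hk => by
      obtain ⟨hz, hzb⟩ := hG.mem_Ioo hh hk
      obtain ⟨Sp, Sm, h5p, _, _⟩ := (hC _ _ hz hzb).2.2.2.2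
      exact h5p.summable.hasSum
    have hm := hα5.hasSum_mul_of_hasSummableGerms hρ hG.rule5m Fm fun h k hh hk => by
      obtain ⟨hz, hzb⟩ := hG.mem_Ioo hh hk
      obtain ⟨Sp, Sm, _, h5m, _⟩ := (hC _ _ hz hzb).2.2.2.2
      exact h5m.summable.hasSum
    refine ⟨α.α₅ Fp, α.α₅ Fm, hp, hm, ?_⟩
    have hzero : α.α₅ (crossF ((D.Δσ + D.Δε) / 2) 1 (fun _ _ => (1 : ℝ)) + Fp - Fm) = 0 := by
      refine hα5.map_eq_zero_of_eqOn hρ fun h k hh hk => ?_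
      obtain ⟨hz, hzb⟩ := hG.mem_Ioo hh hk
      obtain ⟨Sp, Sm, h5p, h5m, h5e⟩ := (hC _ _ hz hzb).2.2.2.2
      simp only [Pi.add_apply, Pi.sub_apply, hFp, hFm]
      rw [h5p.tsum_eq, h5m.tsum_eq]
      exact h5e
    rw [map_sub, map_add] at hzero
    exact hzero

/-- **Box exclusion by a derivative functional (modulo part 3).** If every datum satisfying the
typed axioms with `(Δ_σ, Δ_ε) ∈ Q` has `HasCrossFGerms` at `(x₀,y₀)` (part 3's theorem, taken here as
the hypothesis `hG`; the restriction to `Q` lets part 3 assume e.g. `Δ_σ ≠ Δ_ε`), then a crossing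
functional Taylor at `(x₀,y₀)` and positive (`IsPositiveAt`) at every point of `Q` excludes `Q`
box-uniformly — the derivative-functional analogue of `boxExcluded_of_functional`. [folklore] -/
theorem boxExcluded_of_isTaylorAt (Q : Set (ℝ × ℝ)) (α : CrossingFunctional) {x₀ y₀ : ℝ}
    (hα : IsTaylorAt α x₀ y₀)
    (hG : ∀ D : SigmaEpsilonData, D.SatisfiesBootstrapAxioms → (D.Δσ, D.Δε) ∈ Q →
      ∃ ρ, HasCrossFGerms D x₀ y₀ ρ)
    (hpos : ∀ p ∈ Q, α.IsPositiveAt p.1 p.2) : BoxExcluded Q := by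
  intro D hD hQ
  obtain ⟨ρ, hρ⟩ := hG D hD hQ
  exact CrossingFunctional.not_isPositiveAt_of_appliesTermwise α D hD.2.1 hD.1 hD.2.2.2.2
    (appliesTermwise_of_isTaylorAt α hα D hD.2.2.2.1 hρ) (hpos _ hQ)

end Summit.CriticalPhenomena.Ising3D
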